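import Summits.QuantumFields.YangMills.Theorems.PoincareLipschitzWeakJacobianIdentity
import Mathlib.Analysis.Calculus.BumpFunction.FiniteDimension
import Mathlib.MeasureTheory.Measure.Haar.NormedSpace
import HarnessLib

/-!
# Crux `BlockLipschitzL` (stmt-QuantumFields-23533) ∕ `HistoryTailL` (stmt-QuantumFields-19936), LINE 25 «CompactnessTransfer»,
# stub S1″ — ROAD (W) «the (GAP) with no named fact», brick (W-EN) — file 2 «THE PLANAR CUT-OFFS: SCALE-FREE GRADIENT, CROSS TERM, TAIL»

Cell `ym3-torus` (YM ladder rung R3 = continuum SU(2) Yang–Mills on T³ — a RUNG, NOT Clay: not d = 4, not infinite volume,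
not a mass gap); WIDTH helper seat `ym3-torus-px3` g10 (brick (W-EN) of ★w3-19936 g16's road memo `ROAD-W-WENTE-3PI-w3g16.md`);
`--supports stmt-QuantumFields-23533`; THEOREMS ONLY (0 `def`, 0 `sorry`, default heartbeats); imports px19 g8's
✓`PoincareLipschitzWeakJacobianIdentity` (only for the letter `integrable_mul_of_L2`) and Mathlib (bump functions, Haar scaling).

WHAT THIS FILE PROVES (`E² = EuclideanSpace ℝ (Fin 2)`; `χ₁` any bump centred at `0`, `χ_R := χ₁(R⁻¹ ·)`).
* §1 the scaled cut-offs: smooth, compactly supported, `χ_R = 1` on `‖y‖ ≤ r_in R`, `0 ≤ χ_R ≤ 1`, chain rule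
  `∂_vχ_R = R⁻¹ ∂_vχ₁(R⁻¹·)`, `∇χ_R = 0` on `‖y‖ < r_in R`, and ★ THE SCALE-FREE `L²` NORM OF THE GRADIENT IN THE PLANE
  `∫ (∂_vχ_R)² = ∫ (∂_vχ₁)²` (`dy = R² dz`, `d = 2` — the one place where the dimension enters ROAD (W)'s energy identity).
* §2 ★ `abs_integral_cross_le` — the cut-off cross term `|∫ 2χ_R ∂_vχ_R p g| ≤ 2κ √(∫(∂_vχ₁)²) √(∫_{‖y‖ ≥ r_in R} g²)` for `|p| ≤ κ`,
  `g ∈ L²` (Cauchy–Schwarz), and ★ `tendsto_setIntegral_tail` — `∫_{‖y‖ ≥ r(n+1)} F → 0` for `F ∈ L¹`.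
File 3 (`…HSystemEnergyIdentity`) combines these with file 1's localised row into `∫|∇u|² = −2∫(u − c)J` and the `H`-system rows.
HONEST SCOPE.  Calculus ∕ measure letters on the plane; nothing of (GAP), (TM), S1″, K1, `MeanDeviationL`, `BlockLipschitzL`,
`HistoryTailL` is proved here.  YM₃ on T³ is rung R3, not Clay; YM gap NOT proved; no summit statement is proved here.

References: H. C. Wente, J. Math. Anal. Appl. 26 (1969) 318–344 (energy identity by cut-off) [Wente1969]; H. Brezis, J.-M. Coron,
Arch. Rational Mech. Anal. 89 (1985) 21–56, Appendix [BrezisCoron1985]; L. C. Evans, Partial Differential Equations (2010), §5.3.1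
[Evans2010].
-/

set_option autoImplicit false

noncomputable section

open MeasureTheory Set Filter Function Topology TopologicalSpace ContinuousLinearMap Metric
open scoped ContDiff ENNReal BigOperators Convolution

namespace Summit.QuantumFields.YangMills.Theorems.PoincareLipschitzHSystemEnergyIdentityCutoff

open Literature.Analysis.FunctionSpaces
open Summit.QuantumFields.YangMills.Theorems.PoincareLipschitzWeakJacobianIdentity (integrable_mul_of_L2)

/-! ## §1 The scaled cut-offs -/

section Cutoff

variable (χ₁ : ContDiffBump (0 : EuclideanSpace ℝ (Fin 2))) {R : ℝ}

/-- `χ_R = χ₁(R⁻¹·)` is smooth. [folklore] -/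
theorem contDiff_scaledCutoff (R : ℝ) : ContDiff ℝ ∞ (fun y : EuclideanSpace ℝ (Fin 2) => χ₁ (R⁻¹ • y)) :=
  χ₁.contDiff.comp (contDiff_id.const_smul R⁻¹)

/-- `χ_R` has compact support (`R ≠ 0`). [folklore] -/
theorem hasCompactSupport_scaledCutoff (hR : 0 < R) : HasCompactSupport (fun y : EuclideanSpace ℝ (Fin 2) => χ₁ (R⁻¹ • y)) :=
  χ₁.hasCompactSupport.comp_homeomorph (Homeomorph.smulOfNeZero R⁻¹ (inv_ne_zero hR.ne'))

/-- `χ_R = 1` on `‖y‖ ≤ r_in R`. [folklore] -/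
theorem scaledCutoff_eq_one (hR : 0 < R) {y : EuclideanSpace ℝ (Fin 2)} (hy : ‖y‖ ≤ χ₁.rIn * R) : χ₁ (R⁻¹ • y) = 1 := by
  refine χ₁.one_of_mem_closedBall (mem_closedBall.2 ?_)
  rw [dist_zero_right, norm_smul, norm_inv, Real.norm_of_nonneg hR.le]
  rwa [inv_mul_le_iff₀ hR, mul_comm]

/-- `0 ≤ χ_R ≤ 1`. [folklore] -/
theorem scaledCutoff_mem_Icc (R : ℝ) (y : EuclideanSpace ℝ (Fin 2)) : 0 ≤ χ₁ (R⁻¹ • y) ∧ χ₁ (R⁻¹ • y) ≤ 1 :=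
  ⟨χ₁.nonneg, χ₁.le_one⟩

/-- Chain rule: `∂_v χ_R(y) = R⁻¹ ∂_vχ₁(R⁻¹y)`. [folklore] -/
theorem fderiv_scaledCutoff_apply (R : ℝ) (y v : EuclideanSpace ℝ (Fin 2)) :
    fderiv ℝ (fun y : EuclideanSpace ℝ (Fin 2) => χ₁ (R⁻¹ • y)) y v = R⁻¹ * fderiv ℝ χ₁ (R⁻¹ • y) v := by
  have h1 : HasFDerivAt (fun y : EuclideanSpace ℝ (Fin 2) => R⁻¹ • y) (R⁻¹ • ContinuousLinearMap.id ℝ _) y :=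
    (hasFDerivAt_id y).const_smul R⁻¹
  have h2 : HasFDerivAt χ₁ (fderiv ℝ χ₁ (R⁻¹ • y)) (R⁻¹ • y) :=
    ((χ₁.contDiff (n := 1)).differentiable (by simp) _).hasFDerivAt
  have h : HasFDerivAt (fun y : EuclideanSpace ℝ (Fin 2) => χ₁ (R⁻¹ • y))
      ((fderiv ℝ χ₁ (R⁻¹ • y)).comp (R⁻¹ • ContinuousLinearMap.id ℝ _)) y := h2.comp y h1
  rw [h.fderiv]
  simp only [ContinuousLinearMap.comp_apply, FunLike.coe_smul, Pi.smul_apply, ContinuousLinearMap.id_apply, map_smul,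
    smul_eq_mul]

/-- `∇χ_R = 0` on the open ball `‖y‖ < r_in R` (there `χ_R ≡ 1`). [folklore] -/
theorem fderiv_scaledCutoff_eq_zero (hR : 0 < R) {y : EuclideanSpace ℝ (Fin 2)} (hy : ‖y‖ < χ₁.rIn * R) (v : EuclideanSpace ℝ (Fin 2)) :
    fderiv ℝ (fun y : EuclideanSpace ℝ (Fin 2) => χ₁ (R⁻¹ • y)) y v = 0 := by
  have hev : (fun y : EuclideanSpace ℝ (Fin 2) => χ₁ (R⁻¹ • y)) =ᶠ[𝓝 y] fun _ => (1 : ℝ) := by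
    have ho : IsOpen {z : EuclideanSpace ℝ (Fin 2) | ‖z‖ < χ₁.rIn * R} := isOpen_lt continuous_norm continuous_const
    filter_upwards [ho.mem_nhds hy] with z hz
    exact scaledCutoff_eq_one χ₁ hR (le_of_lt hz)
  rw [hev.fderiv_eq]
  simp

/-- ★ **THE `L²` NORM OF `∇χ_R` IS SCALE-FREE IN THE PLANE**: `∫ (∂_vχ_R)² = ∫ (∂_vχ₁)²` (`∂_vχ_R = R⁻¹∂_vχ₁(R⁻¹·)`, `dy = R² dz`,
`dim = 2`). [folklore] -/
theorem integral_sq_fderiv_scaledCutoff (hR : 0 < R) (v : EuclideanSpace ℝ (Fin 2)) :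
    ∫ y, (fderiv ℝ (fun y : EuclideanSpace ℝ (Fin 2) => χ₁ (R⁻¹ • y)) y v) ^ 2 = ∫ z, (fderiv ℝ χ₁ z v) ^ 2 := by
  simp only [fderiv_scaledCutoff_apply]
  have h := Measure.integral_comp_inv_smul_of_nonneg volume (fun z : EuclideanSpace ℝ (Fin 2) => (fderiv ℝ χ₁ z v) ^ 2) hR.le
  rw [finrank_euclideanSpace_fin] at h
  have e : (fun y : EuclideanSpace ℝ (Fin 2) => (R⁻¹ * fderiv ℝ χ₁ (R⁻¹ • y) v) ^ 2) =
      fun y => R⁻¹ ^ 2 * (fun z : EuclideanSpace ℝ (Fin 2) => (fderiv ℝ χ₁ z v) ^ 2) (R⁻¹ • y) := by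
    funext y; simp only; ring
  rw [e, integral_const_mul, h, smul_eq_mul, ← mul_assoc, inv_pow, inv_mul_cancel₀ (pow_ne_zero 2 hR.ne'), one_mul]

/-- The directional derivative of `χ_R` is square-integrable. [folklore] -/
theorem memLp_fderiv_scaledCutoff (hR : 0 < R) (v : EuclideanSpace ℝ (Fin 2)) :
    MemLp (fun y => fderiv ℝ (fun y : EuclideanSpace ℝ (Fin 2) => χ₁ (R⁻¹ • y)) y v) 2 volume :=
  (((contDiff_scaledCutoff χ₁ R).continuous_fderiv (by simp)).clm_apply continuous_const).memLp_of_hasCompactSupport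
    ((hasCompactSupport_scaledCutoff χ₁ hR).fderiv_apply (𝕜 := ℝ) v)

end Cutoff

/-! ## §2 The cut-off cross term and the energy tail -/

/-- Cauchy–Schwarz letter: `∫ |f| |h| ≤ √(∫ f²) √(∫ h²)` for `f, h ∈ L²`. [folklore] -/
private theorem integral_abs_mul_abs_le {f h : EuclideanSpace ℝ (Fin 2) → ℝ} (hf : MemLp f 2 volume) (hh : MemLp h 2 volume) :
    ∫ y, |f y| * |h y| ≤ Real.sqrt (∫ y, f y ^ 2) * Real.sqrt (∫ y, h y ^ 2) := by
  have hf' : MemLp f (ENNReal.ofReal 2) volume := by simpa using hf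
  have hh' : MemLp h (ENNReal.ofReal 2) volume := by simpa using hh
  have h2 := integral_mul_norm_le_Lp_mul_Lq Real.HolderConjugate.two_two hf' hh'
  have e1 : (∫ y, ‖f y‖ ^ (2 : ℝ)) = ∫ y, f y ^ 2 := by
    congr 1; funext y; rw [Real.rpow_two, Real.norm_eq_abs, sq_abs]
  have e2 : (∫ y, ‖h y‖ ^ (2 : ℝ)) = ∫ y, h y ^ 2 := by
    congr 1; funext y; rw [Real.rpow_two, Real.norm_eq_abs, sq_abs]
  rw [e1, e2, ← Real.sqrt_eq_rpow, ← Real.sqrt_eq_rpow] at h2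
  simpa only [Real.norm_eq_abs] using h2

/-- ★ **THE CUT-OFF CROSS TERM IS SMALL**: for `|p| ≤ κ`, `g ∈ L²` and the cut-off `χ_R = χ₁(R⁻¹·)`,
`|∫ 2 χ_R ∂_vχ_R p g| ≤ 2κ · √(∫(∂_vχ₁)²) · √(∫_{‖y‖ ≥ r_in R} g²)` — the gradient of `χ_R` lives on `‖y‖ ≥ r_in R`, its `L²` norm
does not depend on `R`. [cite: Wente1969, §2; BrezisCoron1985, Appendix (cut-off argument)] -/
theorem abs_integral_cross_le (χ₁ : ContDiffBump (0 : EuclideanSpace ℝ (Fin 2))) {R : ℝ} (hR : 0 < R) (v : EuclideanSpace ℝ (Fin 2))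
    {p g : EuclideanSpace ℝ (Fin 2) → ℝ} {κ : ℝ} (hκ : ∀ y, |p y| ≤ κ) (hg : MemLp g 2 volume) :
    |∫ y, 2 * χ₁ (R⁻¹ • y) * fderiv ℝ (fun y : EuclideanSpace ℝ (Fin 2) => χ₁ (R⁻¹ • y)) y v * p y * g y| ≤
      2 * κ * Real.sqrt (∫ z, (fderiv ℝ χ₁ z v) ^ 2) * Real.sqrt (∫ y in {y | χ₁.rIn * R ≤ ‖y‖}, g y ^ 2) := by
  set A : Set (EuclideanSpace ℝ (Fin 2)) := {y | χ₁.rIn * R ≤ ‖y‖} with hA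
  have hAm : MeasurableSet A := (isClosed_le continuous_const continuous_norm).measurableSet
  have hκ0 : 0 ≤ κ := (abs_nonneg _).trans (hκ 0)
  set D : EuclideanSpace ℝ (Fin 2) → ℝ := fun y => fderiv ℝ (fun y : EuclideanSpace ℝ (Fin 2) => χ₁ (R⁻¹ • y)) y v with hD
  have hDm : MemLp D 2 volume := memLp_fderiv_scaledCutoff χ₁ hR v
  have hgA : MemLp (A.indicator g) 2 volume := hg.indicator hAm
  -- pointwise domination `|2 χ_R ∂χ_R p g| ≤ 2κ |∂χ_R| |1_A g|`
  have hpt : ∀ y, |2 * χ₁ (R⁻¹ • y) * D y * p y * g y| ≤ 2 * κ * (|D y| * |A.indicator g y|) := by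
    intro y
    by_cases hy : y ∈ A
    · rw [indicator_of_mem hy]
      obtain ⟨h0, h1⟩ := scaledCutoff_mem_Icc χ₁ R y
      rw [abs_mul, abs_mul, abs_mul, abs_mul, abs_of_nonneg h0, abs_two]
      have : 2 * χ₁ (R⁻¹ • y) * |D y| * |p y| * |g y| ≤ 2 * 1 * |D y| * κ * |g y| := by
        gcongr
        exact hκ y
      linarith
    · have hy' : ‖y‖ < χ₁.rIn * R := lt_of_not_ge hy
      have hDy : D y = 0 := by simp only [hD]; exact fderiv_scaledCutoff_eq_zero χ₁ hR hy' v
      rw [hDy]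
      simp only [mul_zero, zero_mul, abs_zero]
      positivity
  -- integrate
  have hint : Integrable (fun y => |D y| * |A.indicator g y|) volume := by
    have := integrable_mul_of_L2 hDm hgA
    exact (this.abs).congr (Eventually.of_forall fun y => by simp only [abs_mul])
  have hD2 : ∫ y, D y ^ 2 = ∫ z, (fderiv ℝ χ₁ z v) ^ 2 := by
    simp only [hD]; exact integral_sq_fderiv_scaledCutoff χ₁ hR v
  have hgA2 : ∫ y, A.indicator g y ^ 2 = ∫ y in A, g y ^ 2 := by
    rw [← integral_indicator hAm]
    congr 1; funext y
    by_cases hy : y ∈ A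
    · simp only [indicator_of_mem hy]
    · simp only [indicator_of_notMem hy, ne_eq, OfNat.ofNat_ne_zero, not_false_eq_true, zero_pow]
  calc |∫ y, 2 * χ₁ (R⁻¹ • y) * D y * p y * g y|
      ≤ ∫ y, |2 * χ₁ (R⁻¹ • y) * D y * p y * g y| := by
        rw [← Real.norm_eq_abs]; exact (norm_integral_le_integral_norm _).trans (le_of_eq (by simp only [Real.norm_eq_abs]))
    _ ≤ ∫ y, 2 * κ * (|D y| * |A.indicator g y|) :=
        integral_mono_of_nonneg (Eventually.of_forall fun y => abs_nonneg _) (hint.const_mul _) (Eventually.of_forall hpt)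
    _ = 2 * κ * ∫ y, |D y| * |A.indicator g y| := integral_const_mul _ _
    _ ≤ 2 * κ * (Real.sqrt (∫ y, D y ^ 2) * Real.sqrt (∫ y, A.indicator g y ^ 2)) :=
        mul_le_mul_of_nonneg_left (integral_abs_mul_abs_le hDm hgA) (by positivity)
    _ = 2 * κ * Real.sqrt (∫ z, (fderiv ℝ χ₁ z v) ^ 2) * Real.sqrt (∫ y in A, g y ^ 2) := by
        rw [hD2, hgA2]; ring

/-- ★ **THE ENERGY TAIL VANISHES**: for integrable `F`, `∫_{‖y‖ ≥ r (n+1)} F → 0` (`r > 0`). [folklore] -/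
theorem tendsto_setIntegral_tail {F : EuclideanSpace ℝ (Fin 2) → ℝ} (hF : Integrable F volume) {r : ℝ} (hr : 0 < r) :
    Tendsto (fun n : ℕ => ∫ y in {y : EuclideanSpace ℝ (Fin 2) | r * ((n : ℝ) + 1) ≤ ‖y‖}, F y) atTop (𝓝 0) := by
  set s : ℕ → Set (EuclideanSpace ℝ (Fin 2)) := fun n => {y | r * ((n : ℝ) + 1) ≤ ‖y‖} with hs
  have hsm : ∀ n, MeasurableSet (s n) := fun n => (isClosed_le continuous_const continuous_norm).measurableSet
  have hanti : Antitone s := by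
    intro m n hmn y hy
    have hmn' : (m : ℝ) ≤ n := by exact_mod_cast hmn
    exact le_trans (mul_le_mul_of_nonneg_left (by linarith) hr.le) hy
  have hempty : (⋂ n, s n) = ∅ := by
    refine eq_empty_iff_forall_notMem.2 fun y hy => ?_
    rw [mem_iInter] at hy
    obtain ⟨n, hn⟩ := exists_nat_gt (‖y‖ / r)
    have := hy n
    rw [div_lt_iff₀ hr] at hn
    simp only [hs, mem_setOf_eq] at this
    nlinarith
  have h := tendsto_setIntegral_of_antitone hsm hanti ⟨0, hF.integrableOn⟩
  rwa [hempty, Measure.restrict_empty, integral_zero_measure] at h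

end Summit.QuantumFields.YangMills.Theorems.PoincareLipschitzHSystemEnergyIdentityCutoff
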